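import Literature.Geometry.Kaehler.CechDeRham
import Literature.Geometry.Kaehler.ConnectionExists
import Literature.Geometry.Kaehler.MatrixFormAlgebra
import Literature.NumberTheory.Transcendental.FormsAlgebra
import HarnessLib

/-!
# Čech cocycles of holomorphic Milnor symbols and their `dlog` forms

Layer `Literature/Geometry/Kaehler`. For a complex manifold `M` (charts valued in a complex normed
space `E`) this file sets up the NAIVE analytic Milnor `K`-theory presheaf in weight `p` and its
symbol map to holomorphic `p`-forms, in the concrete, sheaf-free vocabulary of the tree (functions
`M → ℂ` with junk values off the open set where they are used, forms `MForm 𝓘(ℝ, E) M ℂ p` of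
`ManifoldForms`, the ordered Čech conventions `cechSet` / `Fin.succAbove` of `CechDeRham`):

* `IsHolUnitOn E W f` — `f` is an invertible holomorphic function on `W` (a section of `𝒪^*_M`
  over `W`: holomorphic = `MDifferentiableOn 𝓘(ℂ, E) 𝓘(ℂ, ℂ)`, and nowhere zero on `W`);
  `IsGoodTuple E W t` — every entry of the `p`-tuple `t = (f₁, …, f_p)` is such a unit, so that `t`
  names a symbol `{f₁, …, f_p}`; `goodChains E W p` — the free abelian group `ℤ[good tuples]`, as
  the subgroup of `(Fin p → M → ℂ) →₀ ℤ` of finitely supported `ℤ`-combinations of good tuples.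
* `milnorRel E W p` — **the naive Milnor relations in weight `p` over `W`**: the subgroup generated
  by (a) `[t] - [t']` for good tuples that agree pointwise on `W` (the presheaf identification:
  values off `W` are junk), (b) multilinearity `[f₁,…,fᵢg,…] - [f₁,…,fᵢ,…] - [f₁,…,g,…]` and
  (c) the Steinberg relation `[f₁,…,f_p]` whenever `fᵢ + fⱼ = 1` on `W` for some `i ≠ j`. The
  quotient `goodChains / milnorRel` is `K^M_p` of the ring `𝒪(W)` in the naive sense
  `(𝒪(W)^×)^{⊗p} / ⟨Steinberg⟩` (Milnor (1971), §11, Thm. 11.1 and "Steinberg symbols" for `p = 2`;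
  Loday, Def. 7.2 in LNM 1491 for the form "`aᵢ + aⱼ = 1` for some `i ≠ j`"; Green–Griffiths (2005),
  §6.3; Kerz (2009) for the Milnor `K`-sheaf of a ring / scheme; Esnault (1990), §3 for the analytic
  sheaf `𝒦_{2,an}` on `X^an`).
* `dlog E f = f⁻¹ df`, `dlogWedge E p t = dlog f₁ ∧ ⋯ ∧ dlog f_p` (left-nested iterated wedge, built with
  `Fin.hIterate` from the `0`-form `1`) and the **symbol form** `symbolForm E p σ = Σ_t σ(t) · dlogWedge E p t`
  of a chain `σ` — the map `∧^p dlog : 𝒦^M_p → Ω^p` (Green–Griffiths (2005), (6.37);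
  Esnault–Viehweg (1988), §7; Esnault (1990), §3: `dlog ∧ dlog : 𝒦_{2,an} → Ω²_cl`).
* `symbolδ σ` — the ordered Čech differential `(δσ)_{J'} = Σ_j (-1)^j σ_{J' ∘ σ_j}` on cochains of
  chains (Bott–Tu (1982), (8.4), same convention as `cechδ`), `symbolδ_symbolδ : δ ∘ δ = 0`, and
  **`IsMilnorSymbolCocycle E U σ`** — a Čech `n`-cochain `σ` of the open cover `U` with values in
  weight-`p` chains is a MILNOR SYMBOL COCYCLE if `σ_J` is a chain of good tuples on `U_J` and
  `δσ ≡ 0` modulo the Milnor relations on each `U_{J'}`, i.e. `σ` is a cocycle of the cover with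
  coefficients in the presheaf `W ↦ K^M_p(𝒪(W))^naive`; these form the subgroup
  `milnorSymbolCocycles E U n p`.
* **Descent** (`symbolForm_apply_eq_zero_of_mem_milnorRel_one`, `…_two`): on an open `W` the
  symbol form of every Milnor relation of weight `1` or `2` VANISHES at the points of `W`, i.e.
  `dlog : 𝒪^*(W) → Ω¹` and `dlog ∧ dlog : K^M_2(𝒪(W)) → Ω²` are well defined (Esnault–Viehweg (1988),
  §7; Esnault (1990), §3): `dlog` is local, `dlog (fg) = dlog f + dlog g` for holomorphic units
  (multilinearity in every weight, `dlogWedge_update_apply_eq_add`), and `dlog f ∧ dlog g = 0` when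
  `f + g = 1` (`dlogWedge_two_apply_eq_zero_of_add_eq_one`: `dg = -df` and `D ∧ D = 0`).
* The weight-one example (Voisin (2002), Thm. 4.49: `Pic = H¹(X, 𝒪^*_X)`): the transition functions
  `g_ij` of a `HolomorphicLineBundle` give the cochains
  `L.symbolCochain q : J ↦ [g_{J₀J₁}, g_{J₁J₂}, …, g_{J_qJ_{q+1}}]` (the `(q+1)`-fold cup power of the
  transition cocycle), chains of good tuples for every `q` (`symbolCochain_mem_goodChains`) and a
  Milnor symbol `1`-cocycle of weight `1` for `q = 0` (`isMilnorSymbolCocycle_symbolCochain_zero`: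
  the cocycle condition `g_ij g_jk = g_ik` is multilinearity plus the presheaf identification).

Proved API: monotonicity in `W` (`IsHolUnitOn.mono`, `goodChains_antitone`, `milnorRel_antitone`),
closure of units under products and inverses, `milnorRel_le_goodChains`, the generators of
`milnorRel` as membership lemmas, `dlogWedge_zero` / `dlogWedge_succ` (peeling the last factor,
through the general `Fin.hIterate` identity `hIterate_succ_last`), `symbolForm` as the `ℤ`-linear
extension of `dlogWedge` (`symbolFormHom`, `symbolForm_single`, `symbolForm_add`), additivity of
`symbolδ` and `symbolδ_symbolδ`, the subgroup `milnorSymbolCocycles`, the locality and logarithmic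
Leibniz rule of `dlog` at a point (`dlog_congr_of_eventuallyEq`, `dlog_mul_apply`, and for
holomorphic units on an open set `IsHolUnitOn.dlog_mul_apply`), pointwise locality and
multilinearity of `dlogWedge` in every weight (`dlogWedge_congr_apply`,
`dlogWedge_update_apply_eq_add`), the Steinberg vanishing in weight two and the descent theorems in
weights one and two.

## What is NOT here

The sheafification of `W ↦ K^M_p(𝒪(W))` (the tree has no sheaf cohomology for it), the descent of
`symbolForm` to the quotient by `milnorRel` in weight `p ≥ 3` (the Steinberg relation for an
arbitrary pair of slots `i ≠ j` needs the associativity / graded commutativity of `∧`,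
`WedgeAssoc_holds` / `WedgeComm_holds` of `FormsAlgebraWedge*Proofs`, to bring the two slots
together — not done here), holomorphy and closedness of `symbolForm`, and the cocycle property of
the cup powers `L.symbolCochain q` for `q ≥ 1` (Leibniz rule for the Čech cup product).

## References

* J. Milnor, *Introduction to Algebraic K-Theory*, Ann. of Math. Studies 72 (1971), §11
  (Thm. 11.1, Steinberg symbols). [Milnor1972]
* J.-L. Loday, in: E. Lluis-Puebla et al., *Higher Algebraic K-Theory: an overview*, LNM 1491
  (1992), Def. 7.2; H. Gillet, ibid., §4.5–4.6. [LluisPueblaLoday1992HigherK]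
* M. Green, P. Griffiths, *On the Tangent Space to the Space of Algebraic Cycles on a Smooth
  Algebraic Variety*, Ann. of Math. Studies 157 (2005), §6.3, (6.37). [GreenGriffiths2005TangentSpace]
* M. Kerz, *The Gersten conjecture for Milnor K-theory*, Invent. Math. 175 (2009).
  [Kerz2009GerstenMilnorK]
* H. Esnault, *A note on the cycle map*, J. reine angew. Math. 411 (1990), §3. [Esnault1990CycleMap]
* H. Esnault, E. Viehweg, *Deligne–Beilinson cohomology* (1988), §7. [EsnaultViehweg1988DB]
* R. Bott, L. W. Tu, *Differential Forms in Algebraic Topology* (1982), §8 (8.4). [BottTu1982Forms]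
* C. Voisin, *Hodge Theory and Complex Algebraic Geometry I* (2002), §3.3.1, Thm. 4.49.
  [VoisinHodgeI2002]
-/

noncomputable section

open scoped Manifold ContDiff Topology
open Set Filter

namespace Literature.Geometry.Kaehler

variable (E : Type*) [NormedAddCommGroup E] [NormedSpace ℂ E]
  {M : Type*} [TopologicalSpace M] [ChartedSpace E M]

/-! ### Holomorphic units, good tuples and chains of good tuples -/

section Units

/-- **`f` is an invertible holomorphic function on `W`** (a section of `𝒪^*` over `W`): `f` is
holomorphic on `W` (Mathlib's `MDifferentiableOn 𝓘(ℂ, E) 𝓘(ℂ, ℂ)`) and vanishes nowhere on `W`.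
The values of `f` off `W` are junk. Same spelling as the transition functions of
`HolomorphicLineBundle` (Voisin (2002), §3.3.1: "invertible holomorphic functions on `U_i ∩ U_j`").
[cite: VoisinHodgeI2002, §3.3.1 and Thm. 4.49] -/
def IsHolUnitOn (W : Set M) (f : M → ℂ) : Prop :=
  MDifferentiableOn 𝓘(ℂ, E) 𝓘(ℂ, ℂ) f W ∧ ∀ x ∈ W, f x ≠ 0

/-- **A good `p`-tuple on `W`**: every entry of `t = (f₁, …, f_p)` is an invertible holomorphic
function on `W`, so that `t` names a Milnor symbol `{f₁, …, f_p} ∈ K^M_p(𝒪(W))` (an elementary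
tensor of units; Milnor (1971), §11; Loday, LNM 1491, Def. 7.2). [cite: LluisPueblaLoday1992HigherK, Def. 7.2] -/
def IsGoodTuple (W : Set M) {p : ℕ} (t : Fin p → M → ℂ) : Prop :=
  ∀ i, IsHolUnitOn E W (t i)

variable {E}

/-- A holomorphic unit is holomorphic. [folklore] -/
theorem IsHolUnitOn.mdifferentiableOn {W : Set M} {f : M → ℂ} (h : IsHolUnitOn E W f) :
    MDifferentiableOn 𝓘(ℂ, E) 𝓘(ℂ, ℂ) f W :=
  h.1

/-- A holomorphic unit does not vanish on `W`. [folklore] -/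
theorem IsHolUnitOn.ne_zero {W : Set M} {f : M → ℂ} (h : IsHolUnitOn E W f) {x : M} (hx : x ∈ W) :
    f x ≠ 0 :=
  h.2 x hx

/-- Units restrict to smaller sets. [folklore] -/
theorem IsHolUnitOn.mono {W W' : Set M} {f : M → ℂ} (h : IsHolUnitOn E W f) (hW : W' ⊆ W) :
    IsHolUnitOn E W' f :=
  ⟨h.1.mono hW, fun x hx ↦ h.2 x (hW hx)⟩

/-- A non-zero constant is a unit on every set. [folklore] -/
theorem isHolUnitOn_const {c : ℂ} (hc : c ≠ 0) (W : Set M) : IsHolUnitOn E W fun _ ↦ c :=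
  ⟨mdifferentiableOn_const, fun _ _ ↦ hc⟩

/-- The constant `1` is a unit on every set. [folklore] -/
theorem isHolUnitOn_one (W : Set M) : IsHolUnitOn E W (1 : M → ℂ) :=
  isHolUnitOn_const one_ne_zero W

/-- **Units form a group**: the product of two units on `W` is a unit on `W` (`𝒪^*` is a sheaf of
abelian groups). [cite: VoisinHodgeI2002, §3.3.1 and Thm. 4.49] -/
theorem IsHolUnitOn.mul {W : Set M} {f g : M → ℂ} (hf : IsHolUnitOn E W f) (hg : IsHolUnitOn E W g) :
    IsHolUnitOn E W (f * g) :=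
  ⟨hf.1.mul hg.1, fun x hx ↦ mul_ne_zero (hf.2 x hx) (hg.2 x hx)⟩

/-- The inverse of a unit on `W` is a unit on `W`. [cite: VoisinHodgeI2002, §3.3.1 and Thm. 4.49] -/
theorem IsHolUnitOn.inv {W : Set M} {f : M → ℂ} (hf : IsHolUnitOn E W f) : IsHolUnitOn E W f⁻¹ := by
  refine ⟨fun x hx ↦ ?_, fun x hx ↦ inv_ne_zero (hf.2 x hx)⟩
  have h : MDifferentiableAt 𝓘(ℂ, ℂ) 𝓘(ℂ, ℂ) (fun z : ℂ ↦ z⁻¹) (f x) :=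
    ((differentiableAt_inv (𝕜 := ℂ) (hf.2 x hx)).mdifferentiableAt :)
  exact h.comp_mdifferentiableWithinAt x (hf.1 x hx)

/-- Good tuples restrict to smaller sets. [folklore] -/
theorem IsGoodTuple.mono {W W' : Set M} {p : ℕ} {t : Fin p → M → ℂ} (h : IsGoodTuple E W t)
    (hW : W' ⊆ W) : IsGoodTuple E W' t :=
  fun i ↦ (h i).mono hW

/-- Replacing one entry of a good tuple by a unit gives a good tuple. [folklore] -/
theorem IsGoodTuple.update {W : Set M} {p : ℕ} {t : Fin p → M → ℂ} (h : IsGoodTuple E W t)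
    (i : Fin p) {g : M → ℂ} (hg : IsHolUnitOn E W g) : IsGoodTuple E W (Function.update t i g) := by
  intro k
  rcases eq_or_ne k i with rfl | hk
  · rwa [Function.update_self]
  · rw [Function.update_of_ne hk]
    exact h k

/-- The constant tuple `(1, …, 1)` is good. [folklore] -/
theorem isGoodTuple_one (W : Set M) (p : ℕ) : IsGoodTuple E W (1 : Fin p → M → ℂ) :=
  fun _ ↦ isHolUnitOn_one W

/-- The empty tuple is good (weight `0`). [folklore] -/
theorem isGoodTuple_of_isEmpty (W : Set M) (t : Fin 0 → M → ℂ) : IsGoodTuple E W t :=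
  fun i ↦ i.elim0

variable (E) in
/-- **Chains of good tuples on `W`**: the free abelian group `ℤ[good p-tuples on W]`, realised as
the subgroup of the finitely supported functions `(Fin p → M → ℂ) →₀ ℤ` whose support consists of
good tuples (the free abelian group on the elementary tensors of `(𝒪(W)^×)^{⊗p}` before any
relation is imposed; Milnor (1971), §11). [cite: Milnor1972, §11 Thm. 11.1] -/
def goodChains (W : Set M) (p : ℕ) : AddSubgroup ((Fin p → M → ℂ) →₀ ℤ) where
  carrier := {s | ∀ t ∈ s.support, IsGoodTuple E W t}
  add_mem' {a b} ha hb t ht := by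
    classical
    rcases Finset.mem_union.1 (Finsupp.support_add ht) with h | h
    exacts [ha t h, hb t h]
  zero_mem' t ht := by simp at ht
  neg_mem' {a} ha t ht := ha t (by rwa [Finsupp.support_neg] at ht)

/-- Membership in `goodChains` unfolds to "every tuple in the support is good". [folklore] -/
@[simp]
theorem mem_goodChains_iff {W : Set M} {p : ℕ} (s : (Fin p → M → ℂ) →₀ ℤ) :
    s ∈ goodChains E W p ↔ ∀ t ∈ s.support, IsGoodTuple E W t :=
  Iff.rfl

/-- The chain `n · [t]` of a good tuple is a chain of good tuples. [folklore] -/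
theorem single_mem_goodChains {W : Set M} {p : ℕ} {t : Fin p → M → ℂ} (ht : IsGoodTuple E W t)
    (n : ℤ) : Finsupp.single t n ∈ goodChains E W p := fun t' ht' ↦ by
  obtain rfl : t' = t := Finset.mem_singleton.1 (Finsupp.support_single_subset ht')
  exact ht

/-- `goodChains` is antitone in `W`: chains of good tuples on `W` are chains of good tuples on every
`W' ⊆ W` (the restriction maps of the presheaf). [folklore] -/
theorem goodChains_antitone {W W' : Set M} (hW : W' ⊆ W) (p : ℕ) :
    goodChains E W p ≤ goodChains E W' p :=
  fun _ hs t ht ↦ (hs t ht).mono hW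

end Units

/-! ### The naive Milnor relations -/

section Relations

variable {p : ℕ}

/-- **The naive Milnor relations in weight `p` over `W`.** The subgroup of the chains
`(Fin p → M → ℂ) →₀ ℤ` generated by

* (a) `[t] - [t']` for good tuples `t`, `t'` that agree pointwise on `W` (functions are sections
  over `W`; their values off `W` are junk),
* (b) **multilinearity** `[f₁, …, fᵢ g, …, f_p] - [f₁, …, fᵢ, …, f_p] - [f₁, …, g, …, f_p]` for a good
  tuple and a unit `g` on `W` (the defining relations of the tensor product `(𝒪(W)^×)^{⊗p}`),
* (c) the **Steinberg relation** `[f₁, …, f_p]` for a good tuple with `fᵢ + fⱼ = 1` on `W` for some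
  pair `i ≠ j`.

The quotient `goodChains E W p ⧸ milnorRel E W p` is the naive Milnor `K`-group
`K^M_p(𝒪(W)) = (𝒪(W)^×)^{⊗p} / ⟨a₁ ⊗ ⋯ ⊗ a_p : aᵢ + aⱼ = 1 for some i ≠ j⟩` (Loday, LNM 1491,
Def. 7.2, stated for fields; Milnor (1971), Thm. 11.1 (Matsumoto) for `p = 2`:
`{x, 1 - x} = 1`, `{x₁x₂, y} = {x₁, y}{x₂, y}`, `{x, y₁y₂} = {x, y₁}{x, y₂}`; for rings and the
Zariski sheaf `𝒦^M_p` Kerz (2009); for the analytic sheaf `𝒦_{2,an}` Esnault (1990), §3 — all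
sheafify the presheaf `W ↦ K^M_p(𝒪(W))` presented here). [cite: LluisPueblaLoday1992HigherK, Def. 7.2]
[cite: Milnor1972, §11 Thm. 11.1] [cite: Kerz2009GerstenMilnorK] [cite: Esnault1990CycleMap, §3] -/
def milnorRel (W : Set M) (p : ℕ) : AddSubgroup ((Fin p → M → ℂ) →₀ ℤ) :=
  AddSubgroup.closure
    ({s | ∃ t t' : Fin p → M → ℂ, IsGoodTuple E W t ∧ IsGoodTuple E W t' ∧
        (∀ i, ∀ x ∈ W, t i x = t' i x) ∧ s = Finsupp.single t 1 - Finsupp.single t' 1} ∪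
      {s | ∃ (t : Fin p → M → ℂ) (i : Fin p) (g : M → ℂ), IsGoodTuple E W t ∧ IsHolUnitOn E W g ∧
        s = Finsupp.single (Function.update t i (t i * g)) 1 - Finsupp.single t 1 -
          Finsupp.single (Function.update t i g) 1} ∪
      {s | ∃ (t : Fin p → M → ℂ) (i j : Fin p), IsGoodTuple E W t ∧ i ≠ j ∧
        (∀ x ∈ W, t i x + t j x = 1) ∧ s = Finsupp.single t 1})

variable {E}

/-- Relation (a): good tuples that agree on `W` define the same symbol. [folklore] -/
theorem single_sub_single_mem_milnorRel {W : Set M} {t t' : Fin p → M → ℂ} (ht : IsGoodTuple E W t)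
    (ht' : IsGoodTuple E W t') (h : ∀ i, ∀ x ∈ W, t i x = t' i x) :
    Finsupp.single t 1 - Finsupp.single t' 1 ∈ milnorRel E W p :=
  AddSubgroup.subset_closure (Or.inl (Or.inl ⟨t, t', ht, ht', h, rfl⟩))

/-- Relation (b), **multilinearity**: `{f₁, …, fᵢ g, …} = {f₁, …, fᵢ, …} + {f₁, …, g, …}` in
`K^M_p(𝒪(W))` (Milnor (1971), Thm. 11.1 (2)–(3)). [cite: Milnor1972, §11 Thm. 11.1] -/
theorem multilinear_mem_milnorRel {W : Set M} {t : Fin p → M → ℂ} (ht : IsGoodTuple E W t) (i : Fin p)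
    {g : M → ℂ} (hg : IsHolUnitOn E W g) :
    Finsupp.single (Function.update t i (t i * g)) 1 - Finsupp.single t 1 -
        Finsupp.single (Function.update t i g) 1 ∈ milnorRel E W p :=
  AddSubgroup.subset_closure (Or.inl (Or.inr ⟨t, i, g, ht, hg, rfl⟩))

/-- Relation (c), the **Steinberg relation**: `{f₁, …, f_p} = 0` in `K^M_p(𝒪(W))` as soon as
`fᵢ + fⱼ = 1` on `W` for some `i ≠ j` (Loday, LNM 1491, Def. 7.2; Milnor (1971), Thm. 11.1 (1):
`{x, 1 - x} = 1`). [cite: LluisPueblaLoday1992HigherK, Def. 7.2] -/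
theorem steinberg_mem_milnorRel {W : Set M} {t : Fin p → M → ℂ} (ht : IsGoodTuple E W t) {i j : Fin p}
    (hij : i ≠ j) (h : ∀ x ∈ W, t i x + t j x = 1) : Finsupp.single t 1 ∈ milnorRel E W p :=
  AddSubgroup.subset_closure (Or.inr ⟨t, i, j, ht, hij, h, rfl⟩)

/-- **The relations are chains of good tuples**: `milnorRel E W p ≤ goodChains E W p` (every
generator is a combination of good tuples: in (b) the tuples `(…, fᵢ g, …)` and `(…, g, …)` are good
because units are closed under products). [folklore] -/
theorem milnorRel_le_goodChains (W : Set M) (p : ℕ) : milnorRel E W p ≤ goodChains E W p := by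
  refine (AddSubgroup.closure_le _).2 ?_
  rintro s ((⟨t, t', ht, ht', -, rfl⟩ | ⟨t, i, g, ht, hg, rfl⟩) | ⟨t, i, j, ht, -, -, rfl⟩)
  · exact sub_mem (single_mem_goodChains ht 1) (single_mem_goodChains ht' 1)
  · exact sub_mem (sub_mem (single_mem_goodChains (ht.update i ((ht i).mul hg)) 1)
      (single_mem_goodChains ht 1)) (single_mem_goodChains (ht.update i hg) 1)
  · exact single_mem_goodChains ht 1

/-- `milnorRel` is antitone in `W`: a relation over `W` is a relation over every `W' ⊆ W` (the
presheaf `W ↦ K^M_p(𝒪(W))` has restriction maps). [folklore] -/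
theorem milnorRel_antitone {W W' : Set M} (hW : W' ⊆ W) (p : ℕ) :
    milnorRel E W p ≤ milnorRel E W' p := by
  refine (AddSubgroup.closure_le _).2 ?_
  rintro s ((⟨t, t', ht, ht', h, rfl⟩ | ⟨t, i, g, ht, hg, rfl⟩) | ⟨t, i, j, ht, hij, h, rfl⟩)
  · exact single_sub_single_mem_milnorRel (ht.mono hW) (ht'.mono hW) fun i x hx ↦ h i x (hW hx)
  · exact multilinear_mem_milnorRel (ht.mono hW) i (hg.mono hW)
  · exact steinberg_mem_milnorRel (ht.mono hW) hij fun x hx ↦ h x (hW hx)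

end Relations

/-! ### `dlog` forms of symbols -/

section Forms

variable {E}

variable (E) in
/-- **The logarithmic differential** `dlog E f = f⁻¹ df` of a function `f : M → ℂ`, a complex
`1`-form on `M` for the real structure `𝓘(ℝ, E)` underlying the complex charts (`df` is the exterior
derivative `mextDeriv` of the `0`-form `MForm.ofFun 𝓘(ℝ, E) f`). Meaningful where `f` is smooth and
non-zero; elsewhere junk (`0⁻¹ = 0`). The symbol map in weight one, `𝒪^* → Ω¹`, `f ↦ df/f`
(Esnault–Viehweg (1988), §7; Green–Griffiths (2005), (6.18): `b ↦ db/b`). The model space `E` is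
explicit (it is not determined by `M`). [cite: EsnaultViehweg1988DB, §7] -/
def dlog (f : M → ℂ) : MForm 𝓘(ℝ, E) M ℂ 1 := fun x ↦
  (f x)⁻¹ • mextDeriv (MForm.ofFun 𝓘(ℝ, E) f) x

/-- `dlog f` at a point (definitional). [folklore] -/
theorem dlog_apply (f : M → ℂ) (x : M) :
    dlog E f x = (f x)⁻¹ • mextDeriv (MForm.ofFun 𝓘(ℝ, E) f) x :=
  rfl

variable (E) in
/-- **The iterated wedge `dlog f₁ ∧ ⋯ ∧ dlog f_p`** of a `p`-tuple `t = (f₁, …, f_p)`, nested to the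
left and started from the `0`-form `1`: `((1 ∧ dlog f₁) ∧ dlog f₂) ∧ ⋯ ∧ dlog f_p`, built by
`Fin.hIterate` in the degree (so that the result is a `p`-form on the nose, with no degree casts).
The symbol map `∧^p dlog : {f₁, …, f_p} ↦ df₁/f₁ ∧ ⋯ ∧ df_p/f_p` (Green–Griffiths (2005), (6.37) and
the display after (6.18); Esnault (1990), §3: `dlog ∧ dlog` on `𝒦_{2,an}`).
[cite: GreenGriffiths2005TangentSpace, §6.3 (6.37)] [cite: Esnault1990CycleMap, §3] -/
def dlogWedge (p : ℕ) (t : Fin p → M → ℂ) : MForm 𝓘(ℝ, E) M ℂ p :=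
  Fin.hIterate (fun k : ℕ ↦ MForm 𝓘(ℝ, E) M ℂ k) (MForm.ofFun 𝓘(ℝ, E) fun _ : M ↦ (1 : ℂ))
    fun (i : Fin p) (acc : MForm 𝓘(ℝ, E) M ℂ (i : ℕ)) ↦ acc.wedge (dlog E (t i))

variable (E) in
/-- **The symbol form of a chain**: the `ℤ`-linear extension `Σ_t σ(t) · dlog t₁ ∧ ⋯ ∧ dlog t_p` of
`dlogWedge` to finitely supported `ℤ`-combinations of `p`-tuples — the map
`∧^p dlog : ℤ[tuples] → Ω^p` through which `K^M_p(𝒪) → Ω^p_cl` is defined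
(Green–Griffiths (2005), (6.37); Esnault (1990), §3). [cite: GreenGriffiths2005TangentSpace, §6.3 (6.37)] -/
def symbolForm (p : ℕ) (σ : (Fin p → M → ℂ) →₀ ℤ) : MForm 𝓘(ℝ, E) M ℂ p :=
  σ.sum fun t z ↦ z • dlogWedge E p t

/-- **Peeling the last step of `Fin.hIterate`**: iterating `f₀, …, f_n` from `s` is applying `f_n` to
the iteration of `f₀, …, f_{n-1}` (general identity for the core iterator `Fin.hIterate`, which is
defined by forward recursion through `Fin.hIterateFrom`; stated from an arbitrary start index).
[folklore] -/
theorem hIterateFrom_eq_apply_last {P : ℕ → Sort*} :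
    ∀ (d n i : ℕ) (hi : i ≤ n) (_ : i + d = n) (f : ∀ k : Fin (n + 1), P k → P (k + 1)) (a : P i),
      Fin.hIterateFrom P f i (Nat.le_succ_of_le hi) a =
        f (Fin.last n) (Fin.hIterateFrom P (n := n) (fun k ↦ f (Fin.castSucc k)) i hi a)
  | 0, n, i, hi, hd, f, a => by
      obtain rfl : i = n := by omega
      rw [Fin.hIterateFrom, dif_pos i.lt_succ_self, Fin.hIterateFrom, dif_neg (lt_irrefl _),
        Fin.hIterateFrom, dif_neg (lt_irrefl _)]
      rfl
  | d + 1, n, i, hi, hd, f, a => by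
      rw [Fin.hIterateFrom, dif_pos (by omega)]
      conv_rhs => rw [Fin.hIterateFrom, dif_pos (show i < n by omega)]
      exact hIterateFrom_eq_apply_last d n (i + 1) (by omega) (by omega) f _

/-- `Fin.hIterate` over `n + 1` steps is the last step applied to `Fin.hIterate` over the first `n`
steps. [folklore] -/
theorem hIterate_succ_last {P : ℕ → Sort*} {n : ℕ} (s : P 0) (f : ∀ k : Fin (n + 1), P k → P (k + 1)) :
    Fin.hIterate P s f = f (Fin.last n) (Fin.hIterate P s fun k ↦ f (Fin.castSucc k)) :=
  hIterateFrom_eq_apply_last n n 0 (Nat.zero_le n) (Nat.zero_add n) f s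

/-- `Fin.hIterate` over `0` steps is the start value. [folklore] -/
theorem hIterate_zero {P : ℕ → Sort*} (s : P 0) (f : ∀ k : Fin 0, P k → P (k + 1)) :
    Fin.hIterate P s f = s := by
  rw [Fin.hIterate, Fin.hIterateFrom, dif_neg (lt_irrefl _)]
  rfl

/-- In weight `0` the symbol form of the empty tuple is the `0`-form `1`. [folklore] -/
theorem dlogWedge_zero (t : Fin 0 → M → ℂ) :
    dlogWedge E 0 t = MForm.ofFun 𝓘(ℝ, E) fun _ : M ↦ (1 : ℂ) :=
  hIterate_zero _ _

/-- **`dlog f₁ ∧ ⋯ ∧ dlog f_{p+1} = (dlog f₁ ∧ ⋯ ∧ dlog f_p) ∧ dlog f_{p+1}`**: the iterated wedge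
peels off its last factor. [folklore] -/
theorem dlogWedge_succ (p : ℕ) (t : Fin (p + 1) → M → ℂ) :
    dlogWedge E (p + 1) t = (dlogWedge E p fun i ↦ t (Fin.castSucc i)).wedge (dlog E (t (Fin.last p))) :=
  hIterate_succ_last _ _

/-- In weight `1`, `dlogWedge` is `1 ∧ dlog f`, i.e. `dlog f` up to the reindexing `0 + 1 = 1`
(`ContinuousAlternatingMap.constOfIsEmpty_one_wedge`). [folklore] -/
theorem dlogWedge_one_apply (t : Fin 1 → M → ℂ) (x : M) (v : Fin (0 + 1) → TangentSpace 𝓘(ℝ, E) x) :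
    dlogWedge E 1 t x v = dlog E (t 0) x (fun i ↦ v (Fin.cast (Nat.zero_add 1) i)) := by
  rw [dlogWedge_succ, dlogWedge_zero, MForm.wedge_apply]
  exact congrFun (congrArg DFunLike.coe
    (ContinuousAlternatingMap.constOfIsEmpty_one_wedge (𝕜 := ℝ) (V := E) (dlog E (t 0) x))) v

/-- The symbol form of a single tuple: `symbolForm E p (z · [t]) = z · dlogWedge E p t`. [folklore] -/
@[simp]
theorem symbolForm_single (p : ℕ) (t : Fin p → M → ℂ) (z : ℤ) :
    symbolForm E p (Finsupp.single t z) = z • dlogWedge E p t :=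
  Finsupp.sum_single_index (zero_smul ℤ _)

/-- The symbol form of the zero chain vanishes. [folklore] -/
@[simp]
theorem symbolForm_zero (p : ℕ) : symbolForm E p (0 : (Fin p → M → ℂ) →₀ ℤ) = 0 :=
  Finsupp.sum_zero_index

/-- **The symbol form is additive** (it is the `ℤ`-linear extension of `dlogWedge`). [folklore] -/
theorem symbolForm_add (p : ℕ) (σ τ : (Fin p → M → ℂ) →₀ ℤ) :
    symbolForm E p (σ + τ) = symbolForm E p σ + symbolForm E p τ :=
  Finsupp.sum_add_index' (fun _ ↦ zero_smul ℤ _) fun _ _ _ ↦ add_smul _ _ _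

variable (E) in
/-- The symbol form as a homomorphism of abelian groups `ℤ[tuples] →+ Ω^p`. [folklore] -/
def symbolFormHom (p : ℕ) : ((Fin p → M → ℂ) →₀ ℤ) →+ MForm 𝓘(ℝ, E) M ℂ p where
  toFun := symbolForm E p
  map_zero' := symbolForm_zero p
  map_add' := symbolForm_add p

/-- `symbolFormHom` is `symbolForm` (definitional). [folklore] -/
@[simp]
theorem symbolFormHom_apply (p : ℕ) (σ : (Fin p → M → ℂ) →₀ ℤ) :
    symbolFormHom E p σ = symbolForm E p σ :=
  rfl

/-- The symbol form of a difference. [folklore] -/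
theorem symbolForm_sub (p : ℕ) (σ τ : (Fin p → M → ℂ) →₀ ℤ) :
    symbolForm E p (σ - τ) = symbolForm E p σ - symbolForm E p τ :=
  map_sub (symbolFormHom E p) σ τ

/-- The symbol form of a negative. [folklore] -/
theorem symbolForm_neg (p : ℕ) (σ : (Fin p → M → ℂ) →₀ ℤ) :
    symbolForm E p (-σ) = -symbolForm E p σ :=
  map_neg (symbolFormHom E p) σ

/-! #### Calculus of `dlog` at a point -/

/-- **Locality of `dlog`**: functions that agree near `x` have the same `dlog` at `x`. [folklore] -/
theorem dlog_congr_of_eventuallyEq {f g : M → ℂ} {x : M} (h : f =ᶠ[𝓝 x] g) :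
    dlog E f x = dlog E g x := by
  rw [dlog_apply, dlog_apply, h.self_of_nhds]
  congr 1
  refine mextDeriv_congr_of_eventuallyEq ?_
  filter_upwards [h] with w hw
  change ContinuousAlternatingMap.constOfIsEmpty ℝ _ (Fin 0) (f w) =
    ContinuousAlternatingMap.constOfIsEmpty ℝ _ (Fin 0) (g w)
  rw [hw]

variable [IsManifold 𝓘(ℝ, E) ∞ M]

/-- **The logarithmic Leibniz rule** `dlog (fg) = dlog f + dlog g` at a point where `f` and `g` are
real `C^∞` and non-zero (`d(fg) = g df + f dg`, Warner 2.20, divided by `fg`). This is what makes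
`dlog : 𝒪^* → Ω¹` a homomorphism and kills the multilinearity relation (b) in weight one.
[cite: EsnaultViehweg1988DB, §7] -/
theorem dlog_mul_apply {f g : M → ℂ} {x : M} (hf : ContMDiffAt 𝓘(ℝ, E) 𝓘(ℝ, ℂ) ∞ f x)
    (hg : ContMDiffAt 𝓘(ℝ, E) 𝓘(ℝ, ℂ) ∞ g x) (hf0 : f x ≠ 0) (hg0 : g x ≠ 0) :
    dlog E (f * g) x = dlog E f x + dlog E g x := by
  ext v
  rw [dlog_apply, ContinuousAlternatingMap.smul_apply,
    show MForm.ofFun 𝓘(ℝ, E) (f * g) = MForm.ofFun 𝓘(ℝ, E) (fun y ↦ f y * g y) from rfl,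
    mextDeriv_ofFun_mul_apply hf hg, ContinuousAlternatingMap.add_apply, dlog_apply, dlog_apply,
    ContinuousAlternatingMap.smul_apply, ContinuousAlternatingMap.smul_apply, Pi.mul_apply,
    smul_add, smul_smul, smul_smul, mul_inv, mul_assoc, inv_mul_cancel₀ hg0, mul_one,
    mul_comm (f x)⁻¹, mul_assoc, inv_mul_cancel₀ hf0, mul_one]

/-- The logarithmic Leibniz rule for **holomorphic units on an open set**: for `f`, `g` invertible
holomorphic on an open `W` and `x ∈ W`, `dlog (fg) = dlog f + dlog g` at `x` (holomorphic functions
are real `C^∞`, `contMDiffAt_real_of_mdifferentiableOn_complex`). [cite: EsnaultViehweg1988DB, §7] -/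
theorem IsHolUnitOn.dlog_mul_apply [FiniteDimensional ℂ E] [IsManifold 𝓘(ℂ, E) ω M] {W : Set M}
    (hW : IsOpen W) {f g : M → ℂ} (hf : IsHolUnitOn E W f) (hg : IsHolUnitOn E W g) {x : M}
    (hx : x ∈ W) : dlog E (f * g) x = dlog E f x + dlog E g x :=
  Literature.Geometry.Kaehler.dlog_mul_apply (contMDiffAt_real_of_mdifferentiableOn_complex hf.1 hW hx)
    (contMDiffAt_real_of_mdifferentiableOn_complex hg.1 hW hx) (hf.2 x hx) (hg.2 x hx)

end Forms

/-! ### Čech cochains of chains and Milnor symbol cocycles -/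

section CechDifferential

variable {ι α : Type*} {n : ℕ}

/-- **The ordered Čech differential on cochains of chains**:
`(δσ)_{J'} = Σ_{j} (-1)^j σ_{J' ∘ σ_j}`, `σ_j = Fin.succAbove j` omitting the `j`-th index
(Bott–Tu (1982), (8.4); the convention of `cechδ`, without restriction maps: chains on `U_J` are
chains on every smaller set, `goodChains_antitone`). Stated for cochains with values in finitely
supported `ℤ`-combinations of any type `α` of generators (here: `α = Fin p → M → ℂ`, the `p`-tuples).
[cite: BottTu1982Forms, §8 (8.4)] -/
def symbolδ (σ : (Fin (n + 1) → ι) → (α →₀ ℤ)) (J' : Fin (n + 2) → ι) : α →₀ ℤ :=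
  ∑ j : Fin (n + 2), ((-1 : ℤ) ^ (j : ℕ)) • σ (J' ∘ Fin.succAbove j)

/-- The Čech differential, unfolded. [cite: BottTu1982Forms, §8 (8.4)] -/
theorem symbolδ_apply (σ : (Fin (n + 1) → ι) → (α →₀ ℤ)) (J' : Fin (n + 2) → ι) :
    symbolδ σ J' = ∑ j : Fin (n + 2), ((-1 : ℤ) ^ (j : ℕ)) • σ (J' ∘ Fin.succAbove j) :=
  rfl

/-- The Čech differential is additive. [folklore] -/
theorem symbolδ_add (σ τ : (Fin (n + 1) → ι) → (α →₀ ℤ)) :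
    symbolδ (σ + τ) = symbolδ σ + symbolδ τ := by
  funext J'
  simp only [symbolδ, Pi.add_apply, smul_add, Finset.sum_add_distrib]

/-- The Čech differential of the zero cochain vanishes. [folklore] -/
@[simp]
theorem symbolδ_zero : symbolδ (0 : (Fin (n + 1) → ι) → (α →₀ ℤ)) = 0 := by
  funext J'
  simp only [symbolδ, Pi.zero_apply, smul_zero, Finset.sum_const_zero]

/-- The Čech differential of a negative. [folklore] -/
theorem symbolδ_neg (σ : (Fin (n + 1) → ι) → (α →₀ ℤ)) : symbolδ (-σ) = -symbolδ σ := by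
  funext J'
  simp only [symbolδ, Pi.neg_apply, smul_neg, Finset.sum_neg_distrib]

/-- The Čech differential of a difference. [folklore] -/
theorem symbolδ_sub (σ τ : (Fin (n + 1) → ι) → (α →₀ ℤ)) :
    symbolδ (σ - τ) = symbolδ σ - symbolδ τ := by
  rw [sub_eq_add_neg, symbolδ_add, symbolδ_neg, ← sub_eq_add_neg]

/-- **`δ ∘ δ = 0`** for the ordered Čech differential on cochains of chains (the faces
`σ_i ∘ σ_j` cancel in pairs, `CechTuple.sum_sum_neg_one_pow_smul_smul_faces_eq_zero`; Bott–Tu (1982),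
§8). [cite: BottTu1982Forms, §8 (8.4)] -/
theorem symbolδ_symbolδ (σ : (Fin (n + 1) → ι) → (α →₀ ℤ)) : symbolδ (symbolδ σ) = 0 := by
  funext J''
  simp only [symbolδ, Pi.zero_apply, Finset.smul_sum]
  exact Literature.Algebra.Homology.CechTuple.sum_sum_neg_one_pow_smul_smul_faces_eq_zero (R := ℤ)
    fun θ ↦ σ (J'' ∘ θ)

end CechDifferential

section Cech

variable {ι : Type*} {n p : ℕ}

/-- **Milnor symbol cocycles.** An ordered Čech `n`-cochain `σ = (σ_J)_{J : Fin (n+1) → ι}` of the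
open cover `U = (U_i)` with values in weight-`p` chains is a *Milnor symbol `n`-cocycle of weight `p`*
if (i) each `σ_J` is a chain of good tuples on `U_J = ⋂_k U_{J k}` (so it names an element of
`K^M_p(𝒪(U_J))`) and (ii) `(δσ)_{J'} ≡ 0` modulo the Milnor relations over `U_{J'}` for every
`(n+2)`-tuple `J'` — i.e. `σ` is a cocycle of the full ordered Čech complex `C^n(𝔘, 𝒦^M_p)` of the
cover with coefficients in the presheaf `W ↦ K^M_p(𝒪(W))` (Bott–Tu (1982), §8 for the Čech
conventions; for `n = p = 1` these are the `𝒪^*`-valued `1`-cocycles of Voisin (2002), Thm. 4.49,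
modulo the relations; for `p = 2` the cochains of the analytic sheaf `𝒦_{2,an}` of Esnault (1990),
§3, before sheafification). [cite: BottTu1982Forms, §8 (8.4)] [cite: Esnault1990CycleMap, §3]
[cite: VoisinHodgeI2002, Thm. 4.49] -/
def IsMilnorSymbolCocycle (U : ι → Set M) (σ : (Fin (n + 1) → ι) → ((Fin p → M → ℂ) →₀ ℤ)) : Prop :=
  (∀ J, σ J ∈ goodChains E (cechSet U J) p) ∧
    ∀ J' : Fin (n + 2) → ι, symbolδ σ J' ∈ milnorRel E (cechSet U J') p

variable {E}

/-- The components of a Milnor symbol cocycle are chains of good tuples. [folklore] -/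
theorem IsMilnorSymbolCocycle.good {U : ι → Set M} {σ : (Fin (n + 1) → ι) → ((Fin p → M → ℂ) →₀ ℤ)}
    (h : IsMilnorSymbolCocycle E U σ) (J : Fin (n + 1) → ι) {t : Fin p → M → ℂ}
    (ht : t ∈ (σ J).support) : IsGoodTuple E (cechSet U J) t :=
  h.1 J t ht

/-- The cocycle condition of a Milnor symbol cocycle. [folklore] -/
theorem IsMilnorSymbolCocycle.cocycle {U : ι → Set M}
    {σ : (Fin (n + 1) → ι) → ((Fin p → M → ℂ) →₀ ℤ)} (h : IsMilnorSymbolCocycle E U σ)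
    (J' : Fin (n + 2) → ι) : symbolδ σ J' ∈ milnorRel E (cechSet U J') p :=
  h.2 J'

/-- The zero cochain is a Milnor symbol cocycle. [folklore] -/
theorem isMilnorSymbolCocycle_zero (U : ι → Set M) :
    IsMilnorSymbolCocycle E U (0 : (Fin (n + 1) → ι) → ((Fin p → M → ℂ) →₀ ℤ)) :=
  ⟨fun _ ↦ zero_mem _, fun _ ↦ by rw [symbolδ_zero]; exact zero_mem _⟩

/-- Milnor symbol cocycles are closed under addition. [folklore] -/
theorem IsMilnorSymbolCocycle.add {U : ι → Set M}
    {σ τ : (Fin (n + 1) → ι) → ((Fin p → M → ℂ) →₀ ℤ)} (hσ : IsMilnorSymbolCocycle E U σ)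
    (hτ : IsMilnorSymbolCocycle E U τ) : IsMilnorSymbolCocycle E U (σ + τ) :=
  ⟨fun J ↦ add_mem (hσ.1 J) (hτ.1 J), fun J' ↦ by
    rw [symbolδ_add]
    exact add_mem (hσ.2 J') (hτ.2 J')⟩

/-- Milnor symbol cocycles are closed under negation. [folklore] -/
theorem IsMilnorSymbolCocycle.neg {U : ι → Set M}
    {σ : (Fin (n + 1) → ι) → ((Fin p → M → ℂ) →₀ ℤ)} (hσ : IsMilnorSymbolCocycle E U σ) :
    IsMilnorSymbolCocycle E U (-σ) :=
  ⟨fun J ↦ neg_mem (hσ.1 J), fun J' ↦ by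
    rw [symbolδ_neg]
    exact neg_mem (hσ.2 J')⟩

variable (E) in
/-- **The group of Milnor symbol `n`-cocycles of weight `p` of the cover `U`**, `Z^n(𝔘, 𝒦^M_p)`
(before passing to cohomology classes). [cite: BottTu1982Forms, §8 (8.4)] -/
def milnorSymbolCocycles (U : ι → Set M) (n p : ℕ) :
    AddSubgroup ((Fin (n + 1) → ι) → ((Fin p → M → ℂ) →₀ ℤ)) where
  carrier := {σ | IsMilnorSymbolCocycle E U σ}
  add_mem' := IsMilnorSymbolCocycle.add
  zero_mem' := isMilnorSymbolCocycle_zero U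
  neg_mem' := IsMilnorSymbolCocycle.neg

/-- Membership in `milnorSymbolCocycles` unfolds to `IsMilnorSymbolCocycle`. [folklore] -/
@[simp]
theorem mem_milnorSymbolCocycles_iff (U : ι → Set M)
    (σ : (Fin (n + 1) → ι) → ((Fin p → M → ℂ) →₀ ℤ)) :
    σ ∈ milnorSymbolCocycles E U n p ↔ IsMilnorSymbolCocycle E U σ :=
  Iff.rfl

/-- **The symbol forms of a cocycle**: the Čech `n`-cochain of `p`-forms `J ↦ symbolForm (σ_J)`
(`dlog` applied componentwise; the map `C^n(𝔘, 𝒦^M_p) → C^n(𝔘, Ω^p)` whose composite with the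
Čech–de Rham zigzag transgresses symbol cocycles to de Rham classes; Esnault (1990), §3 for
`n = p = 2`). Forms on all of `M`, meaningful on `U_J`. [cite: Esnault1990CycleMap, §3] -/
def symbolForms (σ : (Fin (n + 1) → ι) → ((Fin p → M → ℂ) →₀ ℤ)) (J : Fin (n + 1) → ι) :
    MForm 𝓘(ℝ, E) M ℂ p :=
  symbolForm E p (σ J)

/-- `symbolForms` unfolded (definitional). [folklore] -/
@[simp]
theorem symbolForms_apply (σ : (Fin (n + 1) → ι) → ((Fin p → M → ℂ) →₀ ℤ)) (J : Fin (n + 1) → ι) :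
    symbolForms (E := E) σ J = symbolForm E p (σ J) :=
  rfl

end Cech

/-! ### The weight-one example: transition cocycles of holomorphic line bundles -/

namespace HolomorphicLineBundle

variable {E} {ι : Type*}

/-- **The cup powers of the transition cocycle of a holomorphic line bundle**: on
`U_{J₀} ∩ ⋯ ∩ U_{J_{q+1}}` the single symbol `[g_{J₀J₁}, g_{J₁J₂}, …, g_{J_qJ_{q+1}}]`, an ordered
Čech `(q+1)`-cochain of weight `q + 1` (for `q = 0` the `𝒪^*`-valued `1`-cocycle `(g_ij)` presenting
`L`, Voisin (2002), §3.3.1 / Thm. 4.49; in general the `(q+1)`-fold Čech cup product of it with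
itself, whose symbol form represents `c₁(L)^{q+1}` up to normalisation). [cite: VoisinHodgeI2002, Thm. 4.49] -/
def symbolCochain (L : HolomorphicLineBundle ι E M) (q : ℕ) (J : Fin (q + 2) → ι) :
    (Fin (q + 1) → M → ℂ) →₀ ℤ :=
  Finsupp.single (fun i : Fin (q + 1) ↦ L.coordChange (J (Fin.castSucc i)) (J i.succ)) 1

/-- `symbolCochain` unfolded (definitional). [folklore] -/
theorem symbolCochain_apply (L : HolomorphicLineBundle ι E M) (q : ℕ) (J : Fin (q + 2) → ι) :
    L.symbolCochain q J =
      Finsupp.single (fun i : Fin (q + 1) ↦ L.coordChange (J (Fin.castSucc i)) (J i.succ)) 1 :=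
  rfl

/-- The transition function `g_{J_i J_{i+1}}` is a unit on `U_J`. [cite: VoisinHodgeI2002, §3.3.1] -/
theorem isHolUnitOn_coordChange_cechSet (L : HolomorphicLineBundle ι E M) {m : ℕ} (J : Fin m → ι)
    (a b : Fin m) : IsHolUnitOn E (cechSet L.baseSet J) (L.coordChange (J a) (J b)) :=
  ⟨(L.mdifferentiableOn_coordChange (J a) (J b)).mono fun _ hx ↦
      ⟨cechSet_subset_apply _ J a hx, cechSet_subset_apply _ J b hx⟩,
    fun x hx ↦ L.coordChange_ne_zero (J a) (J b) x
      ⟨cechSet_subset_apply _ J a hx, cechSet_subset_apply _ J b hx⟩⟩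

/-- The tuple `(g_{J₀J₁}, …, g_{J_qJ_{q+1}})` is good on `U_J`. [cite: VoisinHodgeI2002, §3.3.1] -/
theorem isGoodTuple_coordChange (L : HolomorphicLineBundle ι E M) (q : ℕ) (J : Fin (q + 2) → ι) :
    IsGoodTuple E (cechSet L.baseSet J)
      fun i : Fin (q + 1) ↦ L.coordChange (J (Fin.castSucc i)) (J i.succ) :=
  fun i ↦ L.isHolUnitOn_coordChange_cechSet J (Fin.castSucc i) i.succ

/-- **The cup powers are chains of good tuples** on the sets of the cover, in every weight.
[cite: VoisinHodgeI2002, §3.3.1] -/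
theorem symbolCochain_mem_goodChains (L : HolomorphicLineBundle ι E M) (q : ℕ) (J : Fin (q + 2) → ι) :
    L.symbolCochain q J ∈ goodChains E (cechSet L.baseSet J) (q + 1) :=
  single_mem_goodChains (L.isGoodTuple_coordChange q J) 1

/-- **The transition cocycle of a holomorphic line bundle is a Milnor symbol `1`-cocycle of weight
one**: on `U_a ∩ U_b ∩ U_c` the Čech differential `[g_bc] - [g_ac] + [g_ab]` is a Milnor relation,
because `g_ab g_bc = g_ac` there (the cocycle condition, Voisin (2002), §3.3.1), `[g_ab g_bc] ≡ [g_ac]`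
by the presheaf identification (a) and `[g_ab g_bc] ≡ [g_ab] + [g_bc]` by multilinearity (b). This is
the map `Pic X = H¹(X, 𝒪^*) → H¹(𝔘, 𝒦^M_1)` on cocycles. [cite: VoisinHodgeI2002, Thm. 4.49] -/
theorem isMilnorSymbolCocycle_symbolCochain_zero (L : HolomorphicLineBundle ι E M) :
    IsMilnorSymbolCocycle E L.baseSet (L.symbolCochain 0) := by
  refine ⟨fun J ↦ L.symbolCochain_mem_goodChains 0 J, fun J' ↦ ?_⟩
  -- the three faces of `J' = (a, b, c)`
  set W := cechSet L.baseSet J' with hW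
  set a : M → ℂ := L.coordChange (J' 0) (J' 1) with ha
  set b : M → ℂ := L.coordChange (J' 1) (J' 2) with hb
  set c : M → ℂ := L.coordChange (J' 0) (J' 2) with hc
  have hua : IsHolUnitOn E W a := L.isHolUnitOn_coordChange_cechSet J' 0 1
  have hub : IsHolUnitOn E W b := L.isHolUnitOn_coordChange_cechSet J' 1 2
  have huc : IsHolUnitOn E W c := L.isHolUnitOn_coordChange_cechSet J' 0 2
  have h0 : L.symbolCochain 0 (J' ∘ Fin.succAbove 0) = Finsupp.single (fun _ ↦ b) 1 := by
    rw [symbolCochain_apply]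
    congr 1
    funext i
    rw [Subsingleton.elim (α := Fin 1) i 0]
    rfl
  have h1 : L.symbolCochain 0 (J' ∘ Fin.succAbove 1) = Finsupp.single (fun _ ↦ c) 1 := by
    rw [symbolCochain_apply]
    congr 1
    funext i
    rw [Subsingleton.elim (α := Fin 1) i 0]
    rfl
  have h2 : L.symbolCochain 0 (J' ∘ Fin.succAbove 2) = Finsupp.single (fun _ ↦ a) 1 := by
    rw [symbolCochain_apply]
    congr 1
    funext i
    rw [Subsingleton.elim (α := Fin 1) i 0]
    rfl
  have hδ : symbolδ (L.symbolCochain 0) J' =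
      Finsupp.single (fun _ ↦ b) 1 - Finsupp.single (fun _ ↦ c) 1 + Finsupp.single (fun _ ↦ a) 1 := by
    rw [symbolδ_apply, Fin.sum_univ_three, h0, h1, h2]
    simp only [Fin.val_zero, pow_zero, one_smul, Fin.val_one, pow_one, neg_one_smul, Fin.val_two,
      neg_one_sq, sub_eq_add_neg]
  -- the two relations
  have hgood : IsGoodTuple E W (fun _ : Fin 1 ↦ a) := fun _ ↦ hua
  have hmul := multilinear_mem_milnorRel hgood 0 hub
  have hupd₁ : Function.update (fun _ : Fin 1 ↦ a) 0 ((fun _ : Fin 1 ↦ a) 0 * b) = fun _ ↦ a * b := by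
    funext i
    rw [Subsingleton.elim (α := Fin 1) i 0, Function.update_self]
  have hupd₂ : Function.update (fun _ : Fin 1 ↦ a) 0 b = fun _ ↦ b := by
    funext i
    rw [Subsingleton.elim (α := Fin 1) i 0, Function.update_self]
  rw [hupd₁, hupd₂] at hmul
  have hagree : Finsupp.single (fun _ : Fin 1 ↦ c) 1 - Finsupp.single (fun _ : Fin 1 ↦ a * b) 1 ∈
      milnorRel E W 1 :=
    single_sub_single_mem_milnorRel (fun _ ↦ huc) (fun _ ↦ hua.mul hub) fun _ x hx ↦
      (L.coordChange_comp (J' 0) (J' 1) (J' 2) x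
        ⟨⟨cechSet_subset_apply _ J' 0 hx, cechSet_subset_apply _ J' 1 hx⟩,
          cechSet_subset_apply _ J' 2 hx⟩).symm
  rw [hδ]
  convert sub_mem (neg_mem hmul) hagree using 1
  abel

end HolomorphicLineBundle

/-! ### Descent of the symbol form: locality, multilinearity, and Steinberg in weight two -/

section Descent

variable {E} {p : ℕ}

/-- **`dlogWedge` at a point depends only on the `dlog`'s of the entries at that point**
(induction on the weight through `dlogWedge_succ`). [folklore] -/
theorem dlogWedge_congr_apply {t t' : Fin p → M → ℂ} {x : M}
    (h : ∀ i, dlog E (t i) x = dlog E (t' i) x) : dlogWedge E p t x = dlogWedge E p t' x := by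
  induction p with
  | zero => rw [dlogWedge_zero, dlogWedge_zero]
  | succ p ih =>
    rw [dlogWedge_succ, dlogWedge_succ, MForm.wedge_apply, MForm.wedge_apply, h (Fin.last p),
      ih fun i ↦ h (Fin.castSucc i)]

/-- Dropping the last entry of a tuple updated in its last slot. [folklore] -/
theorem dlogWedge_init_update_last (t : Fin (p + 1) → M → ℂ) (b : M → ℂ) :
    (dlogWedge E p fun k ↦ Function.update t (Fin.last p) b (Fin.castSucc k)) =
      dlogWedge E p fun k ↦ t (Fin.castSucc k) :=
  congrArg (dlogWedge E p) (funext fun k ↦ Function.update_of_ne (Fin.castSucc_lt_last k).ne _ _)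

/-- Dropping the last entry of a tuple updated in an earlier slot. [folklore] -/
theorem dlogWedge_init_update_castSucc (t : Fin (p + 1) → M → ℂ) (j : Fin p) (b : M → ℂ) :
    (dlogWedge E p fun k ↦ Function.update t (Fin.castSucc j) b (Fin.castSucc k)) =
      dlogWedge E p (Function.update (fun k ↦ t (Fin.castSucc k)) j b) :=
  congrArg (dlogWedge E p) (Fin.init_update_castSucc (q := t) (i := j) (y := b))

/-- **Multilinearity of `dlogWedge` at a point**: if `dlog h = dlog fᵢ + dlog g` at `x` then
`dlog f₁ ∧ ⋯ ∧ dlog h ∧ ⋯ = dlog f₁ ∧ ⋯ ∧ dlog fᵢ ∧ ⋯ + dlog f₁ ∧ ⋯ ∧ dlog g ∧ ⋯` at `x` (the slot `i`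
being the same on both sides; bilinearity of `∧`, Warner 2.6, by induction on the weight).
[folklore] -/
theorem dlogWedge_update_apply_eq_add {t : Fin p → M → ℂ} {i : Fin p} {g h : M → ℂ} {x : M}
    (hx : dlog E h x = dlog E (t i) x + dlog E g x) :
    dlogWedge E p (Function.update t i h) x =
      dlogWedge E p t x + dlogWedge E p (Function.update t i g) x := by
  induction p with
  | zero => exact i.elim0
  | succ p ih =>
    rw [dlogWedge_succ, dlogWedge_succ, dlogWedge_succ, MForm.wedge_apply, MForm.wedge_apply,
      MForm.wedge_apply]
    induction i using Fin.lastCases with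
    | last =>
      rw [dlogWedge_init_update_last, dlogWedge_init_update_last, Function.update_self,
        Function.update_self, hx]
      exact ContinuousAlternatingMap.wedge_add_right (𝕜 := ℝ) (V := E) (A := ℂ) _ _ _
    | cast j =>
      rw [dlogWedge_init_update_castSucc, dlogWedge_init_update_castSucc,
        Function.update_of_ne (Fin.castSucc_lt_last j).ne',
        Function.update_of_ne (Fin.castSucc_lt_last j).ne',
        ih (t := fun k ↦ t (Fin.castSucc k)) (i := j) hx]
      exact ContinuousAlternatingMap.wedge_add_left (𝕜 := ℝ) (V := E) (A := ℂ) _ _ _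

/-- **`D ∧ D = 0` for a `1`-form** (the shuffle formula in degrees `(1,1)`,
`ContinuousAlternatingMap.wedge_apply_one_one`, and commutativity of `A`). [folklore] -/
theorem wedge_self_eq_zero {V : Type*} [NormedAddCommGroup V] [NormedSpace ℝ V]
    (D : V [⋀^Fin 1]→L[ℝ] ℂ) : D.wedge D = 0 := by
  ext v
  rw [ContinuousAlternatingMap.wedge_apply_one_one, mul_comm, sub_self]
  rfl

/-- `1 ∧ D = D` for the `0`-form `1` and a `1`-form `D` (the reindexing `0 + 1 = 1` of
`ContinuousAlternatingMap.constOfIsEmpty_one_wedge` is invisible on `Fin 1`). [folklore] -/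
theorem one_wedge_eq_self {V : Type*} [NormedAddCommGroup V] [NormedSpace ℝ V]
    (D : V [⋀^Fin 1]→L[ℝ] ℂ) :
    ((ContinuousAlternatingMap.constOfIsEmpty ℝ V (Fin 0) (1 : ℂ)).wedge D :
      V [⋀^Fin (0 + 1)]→L[ℝ] ℂ) = D := by
  rw [ContinuousAlternatingMap.constOfIsEmpty_one_wedge]
  ext v
  rfl

/-- `(1 ∧ D) ∧ (c • D) = 0` for a `1`-form `D` and an algebra scalar `c` (from `1 ∧ D = D` and
`D ∧ D = 0`). [folklore] -/
theorem one_wedge_wedge_smul_self_eq_zero {V : Type*} [NormedAddCommGroup V] [NormedSpace ℝ V]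
    (D : V [⋀^Fin 1]→L[ℝ] ℂ) (c : ℂ) :
    ((ContinuousAlternatingMap.constOfIsEmpty ℝ V (Fin 0) (1 : ℂ)).wedge D).wedge (c • D) = 0 := by
  rw [ContinuousAlternatingMap.wedge_algebra_smul, one_wedge_eq_self]
  have h2 : (ContinuousAlternatingMap.wedge (k := 0 + 1) D D : V [⋀^Fin (0 + 1 + 1)]→L[ℝ] ℂ) = 0 :=
    wedge_self_eq_zero D
  rw [h2]
  exact smul_zero (A := V [⋀^Fin (0 + 1 + 1)]→L[ℝ] ℂ) c

/-- **`d g = -d f` when `f + g = 1` near a point** (for `f`, `g` real `C^∞` at the point):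
`d` is local and additive and kills constants. [folklore] -/
theorem mextDeriv_ofFun_eq_neg_of_add_eq_one {f g : M → ℂ} {x : M}
    (hf : ContMDiffAt 𝓘(ℝ, E) 𝓘(ℝ, ℂ) ∞ f x) (hg : ContMDiffAt 𝓘(ℝ, E) 𝓘(ℝ, ℂ) ∞ g x)
    (h : ∀ᶠ y in 𝓝 x, f y + g y = 1) :
    mextDeriv (MForm.ofFun 𝓘(ℝ, E) g) x = -mextDeriv (MForm.ofFun 𝓘(ℝ, E) f) x := by
  have hsum : ∀ᶠ y in 𝓝 x, (MForm.ofFun 𝓘(ℝ, E) f + MForm.ofFun 𝓘(ℝ, E) g) y =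
      MForm.ofFun 𝓘(ℝ, E) (fun _ : M ↦ (1 : ℂ)) y := by
    filter_upwards [h] with y hy
    ext v
    change f y + g y = 1
    exact hy
  have hd0 : mextDeriv (MForm.ofFun 𝓘(ℝ, E) f + MForm.ofFun 𝓘(ℝ, E) g) x = 0 := by
    rw [mextDeriv_congr_of_eventuallyEq hsum, mextDeriv_ofFun_const]
    rfl
  rw [mextDeriv_add_apply (MForm.smoothAt_ofFun_of_contMDiffAt hf)
    (MForm.smoothAt_ofFun_of_contMDiffAt hg)] at hd0
  exact eq_neg_of_add_eq_zero_right hd0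

/-- **`dlog (1 - f)` is a pointwise multiple of `dlog f`**: if `f + g = 1` near `x` (both real
`C^∞` at `x`, `f x ≠ 0`) then `dlog g = -(g⁻¹ f) · dlog f` at `x` (`dg = -df`). This is the
computation behind "`dlog ∧ dlog` kills the Steinberg relation `{f, 1 - f}`" (Esnault–Viehweg (1988),
§7; Green–Griffiths (2005), §6.3). [cite: EsnaultViehweg1988DB, §7] -/
theorem dlog_eq_smul_dlog_of_add_eq_one {f g : M → ℂ} {x : M}
    (hf : ContMDiffAt 𝓘(ℝ, E) 𝓘(ℝ, ℂ) ∞ f x) (hg : ContMDiffAt 𝓘(ℝ, E) 𝓘(ℝ, ℂ) ∞ g x)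
    (hf0 : f x ≠ 0) (h : ∀ᶠ y in 𝓝 x, f y + g y = 1) :
    dlog E g x = (-((g x)⁻¹ * f x)) • dlog E f x := by
  rw [dlog_apply, dlog_apply, mextDeriv_ofFun_eq_neg_of_add_eq_one hf hg h, smul_neg, smul_smul,
    neg_mul, neg_smul, mul_assoc, mul_inv_cancel₀ hf0, mul_one]

/-- **The Steinberg relation in weight two: `dlog f ∧ dlog g = 0` at `x` when `f + g = 1` near
`x`** (for the pair read in the order `(t₀, t₁)`; `f`, `g` real `C^∞` at `x` with `f x ≠ 0`):
`dlog g` is a pointwise multiple of `dlog f` and `D ∧ D = 0`. The symbol map `dlog ∧ dlog` on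
`𝒦_{2,an}` (Esnault (1990), §3) is well defined because of this. [cite: Esnault1990CycleMap, §3]
[cite: EsnaultViehweg1988DB, §7] -/
theorem dlogWedge_two_apply_eq_zero_of_add_eq_one {t : Fin 2 → M → ℂ} {x : M}
    (h0 : ContMDiffAt 𝓘(ℝ, E) 𝓘(ℝ, ℂ) ∞ (t 0) x) (h1 : ContMDiffAt 𝓘(ℝ, E) 𝓘(ℝ, ℂ) ∞ (t 1) x)
    (hx0 : t 0 x ≠ 0) (h : ∀ᶠ y in 𝓝 x, t 0 y + t 1 y = 1) : dlogWedge E 2 t x = 0 := by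
  have hc := dlog_eq_smul_dlog_of_add_eq_one h0 h1 hx0 h
  rw [dlogWedge_succ, dlogWedge_succ, dlogWedge_zero, MForm.wedge_apply, MForm.wedge_apply]
  simp only [show Fin.castSucc (Fin.last 0) = (0 : Fin 2) from rfl,
    show Fin.last 1 = (1 : Fin 2) from rfl, hc]
  exact one_wedge_wedge_smul_self_eq_zero (V := E) (dlog E (t 0) x) _

/-! #### The descent theorems in weights one and two -/

variable [FiniteDimensional ℂ E] [IsManifold 𝓘(ℂ, E) ω M] [IsManifold 𝓘(ℝ, E) ∞ M]

/-- **The symbol form kills the locality and multilinearity relations in every weight**: on an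
open `W`, the generators (a) (good tuples agreeing on `W`) and (b) (multilinearity) of `milnorRel`
have symbol form vanishing at the points of `W` (`dlog` is local and logarithmically additive on
holomorphic units, Esnault–Viehweg (1988), §7: `dlog` is a homomorphism of sheaves `𝒪^* → Ω¹`).
[cite: EsnaultViehweg1988DB, §7] -/
theorem symbolForm_apply_eq_zero_of_generator {W : Set M} (hW : IsOpen W) {x : M} (hx : x ∈ W)
    {s : (Fin p → M → ℂ) →₀ ℤ}
    (hs : s ∈ ({s | ∃ t t' : Fin p → M → ℂ, IsGoodTuple E W t ∧ IsGoodTuple E W t' ∧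
        (∀ i, ∀ x ∈ W, t i x = t' i x) ∧ s = Finsupp.single t 1 - Finsupp.single t' 1} ∪
      {s | ∃ (t : Fin p → M → ℂ) (i : Fin p) (g : M → ℂ), IsGoodTuple E W t ∧ IsHolUnitOn E W g ∧
        s = Finsupp.single (Function.update t i (t i * g)) 1 - Finsupp.single t 1 -
          Finsupp.single (Function.update t i g) 1} : Set ((Fin p → M → ℂ) →₀ ℤ))) :
    symbolForm E p s x = 0 := by
  rcases hs with ⟨t, t', -, -, h, rfl⟩ | ⟨t, i, g, ht, hg, rfl⟩
  · -- (a) tuples agreeing on `W`: locality of `dlog`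
    rw [symbolForm_sub, symbolForm_single, symbolForm_single, one_smul, one_smul, Pi.sub_apply,
      sub_eq_zero]
    exact dlogWedge_congr_apply fun i ↦
      dlog_congr_of_eventuallyEq (eventuallyEq_of_mem (hW.mem_nhds hx) fun y hy ↦ h i y hy)
  · -- (b) multilinearity: the logarithmic Leibniz rule
    rw [symbolForm_sub, symbolForm_sub, symbolForm_single, symbolForm_single, symbolForm_single,
      one_smul, one_smul, one_smul, Pi.sub_apply, Pi.sub_apply,
      dlogWedge_update_apply_eq_add ((ht i).dlog_mul_apply hW hg hx), add_sub_cancel_left, sub_self]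

/-- **The symbol form descends to `K^M_1` in weight one**: on an open subset `W` of a complex
manifold, the symbol form `Σ n_f · dlog f` of every naive Milnor relation of weight one VANISHES at
the points of `W` (relations (a), (b) by `symbolForm_apply_eq_zero_of_generator`; there is no
Steinberg relation in weight one). Hence `symbolForm E 1` factors through
`𝒪^*(W) = goodChains / milnorRel` pointwise on `W`: the map `dlog : 𝒪^* → Ω¹`.
[cite: EsnaultViehweg1988DB, §7] -/
theorem symbolForm_apply_eq_zero_of_mem_milnorRel_one {W : Set M} (hW : IsOpen W)
    {s : (Fin 1 → M → ℂ) →₀ ℤ} (hs : s ∈ milnorRel E W 1) {x : M} (hx : x ∈ W) :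
    symbolForm E 1 s x = 0 := by
  induction hs using AddSubgroup.closure_induction with
  | mem s h =>
    rcases h with h | ⟨t, i, j, -, hij, -, rfl⟩
    · exact symbolForm_apply_eq_zero_of_generator hW hx h
    · exact absurd (Subsingleton.elim i j) hij
  | zero => rw [symbolForm_zero, Pi.zero_apply]
  | add a b _ _ ha hb => rw [symbolForm_add, Pi.add_apply, ha, hb, add_zero]
  | neg a _ ha => rw [symbolForm_neg, Pi.neg_apply, ha, neg_zero]

/-- **The symbol form `dlog ∧ dlog` descends to `K^M_2` in weight two**: on an open subset `W` of a
complex manifold, the symbol form `Σ n · dlog f ∧ dlog g` of every naive Milnor relation of weight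
two vanishes at the points of `W` — relations (a), (b) by locality and the logarithmic Leibniz rule,
and the Steinberg relation `{f, g}`, `f + g = 1` on `W` (in either order of the two slots) by
`dlogWedge_two_apply_eq_zero_of_add_eq_one`. This is the well-definedness of
`dlog ∧ dlog : 𝒦_{2,an} → Ω²` (Esnault (1990), §3; Esnault–Viehweg (1988), §7) on the presheaf level.
[cite: Esnault1990CycleMap, §3] [cite: EsnaultViehweg1988DB, §7] -/
theorem symbolForm_apply_eq_zero_of_mem_milnorRel_two {W : Set M} (hW : IsOpen W)
    {s : (Fin 2 → M → ℂ) →₀ ℤ} (hs : s ∈ milnorRel E W 2) {x : M} (hx : x ∈ W) :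
    symbolForm E 2 s x = 0 := by
  induction hs using AddSubgroup.closure_induction with
  | mem s h =>
    rcases h with h | ⟨t, i, j, ht, hij, h, rfl⟩
    · exact symbolForm_apply_eq_zero_of_generator hW hx h
    · -- (c) the Steinberg relation, slots `(i, j) = (0, 1)` or `(1, 0)`
      rw [symbolForm_single, one_smul]
      have hsm : ∀ k, ContMDiffAt 𝓘(ℝ, E) 𝓘(ℝ, ℂ) ∞ (t k) x := fun k ↦
        contMDiffAt_real_of_mdifferentiableOn_complex (ht k).1 hW hx
      have hev : ∀ᶠ y in 𝓝 x, t i y + t j y = 1 := eventually_of_mem (hW.mem_nhds hx) h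
      fin_cases i <;> fin_cases j
      · exact absurd rfl hij
      · exact dlogWedge_two_apply_eq_zero_of_add_eq_one (hsm 0) (hsm 1) ((ht 0).2 x hx) hev
      · exact dlogWedge_two_apply_eq_zero_of_add_eq_one (hsm 0) (hsm 1) ((ht 0).2 x hx)
          (hev.mono fun y hy ↦ by rwa [add_comm] at hy)
      · exact absurd rfl hij
  | zero => rw [symbolForm_zero, Pi.zero_apply]
  | add a b _ _ ha hb => rw [symbolForm_add, Pi.add_apply, ha, hb, add_zero]
  | neg a _ ha => rw [symbolForm_neg, Pi.neg_apply, ha, neg_zero]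

end Descent

end Literature.Geometry.Kaehler
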